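import Summits.Ventures.PercRepro.RankLevelSetLevelElevenInfraGXT

/-!
# PercRepro — THE MID WEIGHT `σ_m` IN CLOSED FORM: `Σ_{j < D} C(F, j)/quart(j + 1) ≤ σ̄(F, D)` with
`σ̄(F, D) = Σ_{j < min D 60} C(F, j)/quart(j + 1) + [60 < D]·(66/5)·2^{F+4}/((F+1)(F+2)(F+3)(F+4))`
(p2, gen 36; a feeder for S4 — the top of the `q = 11` window, from `1,554`)

The giant-exact count weighs the pairs of `E` by `σ_m = Σ_{j < d − q} C(F, j)/quart(j + 1)` with the quartic multiplicity
`quart(ν) = ν + 3·C(ν, 2) + 3·C(ν, 3) + 2·C(ν, 4)`; at level `11` the sum has up to `1,376` terms with `F ≤ 1,267`, and evaluating it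
term by term is the whole cost of a cell certificate. Since `12·quart(j + 1) = (j + 1)(j³ + 3j² + 14j + 12)`, for `j ≥ 60`
`5·(j + 1)(j + 2)(j + 3)(j + 4) ≤ 66·quart(j + 1)` (`quart_mul_ge_of_sixty_le`), and
`C(F, j)·(F + 1)(F + 2)(F + 3)(F + 4) = C(F + 4, j + 4)·(j + 1)(j + 2)(j + 3)(j + 4)` (`choose_mul_four_eq`), so the tail
`j ≥ 60` of `σ_m` is at most `(66/5)·Σ_j C(F + 4, j + 4)/P₄(F) ≤ (66/5)·2^{F+4}/P₄(F)` — a closed form that costs nothing.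
* **`sigma_le_sigma_bar`** — the bound, for every `F` and `D`; the first `min D 60` terms stay exact (so that the small cells,
  where the sum has few terms, lose nothing; the cells above lose at most the factor `13.2/12` on the tail).
Axioms: standard.
-/

set_option exponentiation.threshold 4096

namespace PercRepro

namespace ThmN

/-- `12·quart(j + 1) = (j + 1)·(j³ + 3j² + 14j + 12)` for `j = m + 3`, written with the closed forms of the binomials. -/
theorem twelve_mul_quart_eq (m : ℕ) :
    12 * ((m + 3 + 1) + 3 * (m + 3 + 1).choose 2 + 3 * (m + 3 + 1).choose 3 + 2 * (m + 3 + 1).choose 4) =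
      (m + 4) * ((m + 3) ^ 3 + 3 * (m + 3) ^ 2 + 14 * (m + 3) + 12) := by
  have h2 : 2 * (m + 2 + 2).choose 2 = (m + 2 + 1) * (m + 2 + 2) := choose_two_mul (m + 2)
  have h3 : 6 * (m + 1 + 3).choose 3 = (m + 1 + 1) * (m + 1 + 2) * (m + 1 + 3) := choose_three_mul (m + 1)
  have h4 : 24 * (m + 4).choose 4 = (m + 1) * (m + 2) * (m + 3) * (m + 4) := choose_four_mul m
  rw [show m + 2 + 2 = m + 3 + 1 by ring] at h2
  rw [show m + 1 + 3 = m + 3 + 1 by ring] at h3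
  rw [show m + 4 = m + 3 + 1 by ring] at h4
  -- `12·(3·C₂) = 18·(2·C₂)`, `12·(3·C₃) = 6·(6·C₃)`, `12·(2·C₄) = 24·C₄`
  have e : 12 * ((m + 3 + 1) + 3 * (m + 3 + 1).choose 2 + 3 * (m + 3 + 1).choose 3 + 2 * (m + 3 + 1).choose 4) =
      12 * (m + 3 + 1) + 18 * (2 * (m + 3 + 1).choose 2) + 6 * (6 * (m + 3 + 1).choose 3) + 24 * (m + 3 + 1).choose 4 := by
    ring
  rw [e, h2, h3, h4]
  ring

/-- **The quartic multiplicity beats `(5/66)·(j + 1)(j + 2)(j + 3)(j + 4)` from `j = 60` on**: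
`5·(j + 1)(j + 2)(j + 3)(j + 4) ≤ 66·quart(j + 1)` for `60 ≤ j`. -/
theorem quart_mul_ge_of_sixty_le (j : ℕ) (hj : 60 ≤ j) :
    5 * ((j + 1) * (j + 2) * (j + 3) * (j + 4)) ≤
      66 * ((j + 1) + 3 * (j + 1).choose 2 + 3 * (j + 1).choose 3 + 2 * (j + 1).choose 4) := by
  obtain ⟨m, rfl⟩ : ∃ m, j = m + 3 := ⟨j - 3, by omega⟩
  have hq := twelve_mul_quart_eq m
  have hm : 57 ≤ m := by omega
  -- `60·(quart·12) = 66·(12·quart)·(60/66)`: show `60·P₄ ≤ 66·(12·quart)`, i.e. `5·P₄·12 ≤ 66·(12·quart)`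
  have key : 60 * ((m + 3 + 1) * (m + 3 + 2) * (m + 3 + 3) * (m + 3 + 4)) ≤
      66 * ((m + 4) * ((m + 3) ^ 3 + 3 * (m + 3) ^ 2 + 14 * (m + 3) + 12)) := by
    nlinarith [hm, Nat.zero_le m, sq_nonneg m, Nat.mul_le_mul hm hm, Nat.mul_le_mul (Nat.mul_le_mul hm hm) hm]
  have : 12 * (5 * ((m + 3 + 1) * (m + 3 + 2) * (m + 3 + 3) * (m + 3 + 4))) ≤
      66 * (12 * ((m + 3 + 1) + 3 * (m + 3 + 1).choose 2 + 3 * (m + 3 + 1).choose 3 + 2 * (m + 3 + 1).choose 4)) := by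
    rw [hq]; linarith [key]
  have h12 : 12 * (5 * ((m + 3 + 1) * (m + 3 + 2) * (m + 3 + 3) * (m + 3 + 4))) ≤
      12 * (66 * ((m + 3 + 1) + 3 * (m + 3 + 1).choose 2 + 3 * (m + 3 + 1).choose 3 + 2 * (m + 3 + 1).choose 4)) := by
    linarith [this]
  exact Nat.le_of_mul_le_mul_left h12 (by norm_num)

/-- `C(F, j)·(F + 1)(F + 2)(F + 3)(F + 4) = C(F + 4, j + 4)·(j + 1)(j + 2)(j + 3)(j + 4)` (four steps of
`(n + 1)·C(n, k) = C(n + 1, k + 1)·(k + 1)`). -/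
theorem choose_mul_four_eq (F j : ℕ) :
    F.choose j * ((F + 1) * (F + 2) * (F + 3) * (F + 4)) =
      (F + 4).choose (j + 4) * ((j + 1) * (j + 2) * (j + 3) * (j + 4)) := by
  have h1 := Nat.add_one_mul_choose_eq F j
  have h2 := Nat.add_one_mul_choose_eq (F + 1) (j + 1)
  have h3 := Nat.add_one_mul_choose_eq (F + 2) (j + 2)
  have h4 := Nat.add_one_mul_choose_eq (F + 3) (j + 3)
  rw [show F + 1 + 1 = F + 2 by ring, show j + 1 + 1 = j + 2 by ring] at h2
  rw [show F + 2 + 1 = F + 3 by ring, show j + 2 + 1 = j + 3 by ring] at h3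
  rw [show F + 3 + 1 = F + 4 by ring, show j + 3 + 1 = j + 4 by ring] at h4
  calc F.choose j * ((F + 1) * (F + 2) * (F + 3) * (F + 4))
      = ((F + 1) * F.choose j) * (F + 2) * (F + 3) * (F + 4) := by ring
    _ = ((F + 1).choose (j + 1) * (j + 1)) * (F + 2) * (F + 3) * (F + 4) := by rw [h1]
    _ = ((F + 2) * (F + 1).choose (j + 1)) * (j + 1) * (F + 3) * (F + 4) := by ring
    _ = ((F + 2).choose (j + 2) * (j + 2)) * (j + 1) * (F + 3) * (F + 4) := by rw [h2]
    _ = ((F + 3) * (F + 2).choose (j + 2)) * (j + 2) * (j + 1) * (F + 4) := by ring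
    _ = ((F + 3).choose (j + 3) * (j + 3)) * (j + 2) * (j + 1) * (F + 4) := by rw [h3]
    _ = ((F + 4) * (F + 3).choose (j + 3)) * (j + 3) * (j + 2) * (j + 1) := by ring
    _ = ((F + 4).choose (j + 4) * (j + 4)) * (j + 3) * (j + 2) * (j + 1) := by rw [h4]
    _ = (F + 4).choose (j + 4) * ((j + 1) * (j + 2) * (j + 3) * (j + 4)) := by ring

/-- `Σ_{i < N} C(M, i) ≤ 2^M` for every `N` (the terms beyond `M` vanish). -/
theorem sum_range_choose_le_two_pow (M N : ℕ) : ∑ i ∈ Finset.range N, M.choose i ≤ 2 ^ M := by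
  rcases Nat.lt_or_ge (M + 1) N with h | h
  · rw [← Finset.sum_range_add_sum_Ico _ (le_of_lt h), Nat.sum_range_choose]
    have hz : ∑ i ∈ Finset.Ico (M + 1) N, M.choose i = 0 := by
      apply Finset.sum_eq_zero
      intro i hi
      rw [Finset.mem_Ico] at hi
      exact Nat.choose_eq_zero_of_lt (by omega)
    rw [hz, add_zero]
  · calc ∑ i ∈ Finset.range N, M.choose i ≤ ∑ i ∈ Finset.range (M + 1), M.choose i :=
          Finset.sum_le_sum_of_subset (Finset.range_mono h)
      _ = 2 ^ M := Nat.sum_range_choose M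

/-- The shifted tail of the binomial row: `Σ_{j ∈ Ico a D} C(F + 4, j + 4) ≤ 2^{F+4}`. -/
theorem sum_Ico_choose_add_four_le_two_pow (F a D : ℕ) :
    ∑ j ∈ Finset.Ico a D, (F + 4).choose (j + 4) ≤ 2 ^ (F + 4) := by
  rw [Finset.sum_Ico_add' (fun j => (F + 4).choose j) a D 4]
  calc ∑ j ∈ Finset.Ico (a + 4) (D + 4), (F + 4).choose j
      ≤ ∑ j ∈ Finset.range (D + 4), (F + 4).choose j := by
        rw [Finset.range_eq_Ico]
        exact Finset.sum_le_sum_of_subset (Finset.Ico_subset_Ico_left (Nat.zero_le _))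
    _ ≤ 2 ^ (F + 4) := sum_range_choose_le_two_pow (F + 4) (D + 4)

/-- **THE MID WEIGHT IN CLOSED FORM**: for every `F` and `D`,
`Σ_{j < D} C(F, j)/quart(j + 1) ≤ Σ_{j < min D 60} C(F, j)/quart(j + 1) + [60 < D]·(66/5)·2^{F+4}/((F+1)(F+2)(F+3)(F+4))`. -/
theorem sigma_le_sigma_bar (F D : ℕ) :
    ∑ j ∈ Finset.range D, ((F.choose j : ℕ) : ℚ) / (((j + 1) + 3 * (j + 1).choose 2 + 3 * (j + 1).choose 3 + 2 * (j + 1).choose 4 : ℕ) : ℚ) ≤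
      ∑ j ∈ Finset.range (min D 60), ((F.choose j : ℕ) : ℚ) / (((j + 1) + 3 * (j + 1).choose 2 + 3 * (j + 1).choose 3 + 2 * (j + 1).choose 4 : ℕ) : ℚ) +
      (if 60 < D then (66 / 5 : ℚ) * 2 ^ (F + 4) / (((F + 1) * (F + 2) * (F + 3) * (F + 4) : ℕ) : ℚ) else 0) := by
  rcases Nat.lt_or_ge 60 D with hD | hD
  swap
  · rw [min_eq_left hD, if_neg (by omega), add_zero]
  · rw [min_eq_right (le_of_lt hD), if_pos hD]
    rw [← Finset.sum_range_add_sum_Ico _ (le_of_lt hD)]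
    refine add_le_add (le_refl _) ?_
    -- the tail `60 ≤ j < D`: each term `≤ (66/5)·C(F + 4, j + 4)/P₄(F)`
    have hP : (0 : ℚ) < (((F + 1) * (F + 2) * (F + 3) * (F + 4) : ℕ) : ℚ) := by positivity
    have hterm : ∀ j ∈ Finset.Ico 60 D,
        ((F.choose j : ℕ) : ℚ) / (((j + 1) + 3 * (j + 1).choose 2 + 3 * (j + 1).choose 3 + 2 * (j + 1).choose 4 : ℕ) : ℚ) ≤
          (66 / 5 : ℚ) * (((F + 4).choose (j + 4) : ℕ) : ℚ) / (((F + 1) * (F + 2) * (F + 3) * (F + 4) : ℕ) : ℚ) := by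
      intro j hj
      rw [Finset.mem_Ico] at hj
      have hq := quart_mul_ge_of_sixty_le j hj.1
      have hc := choose_mul_four_eq F j
      have hQ : (0 : ℚ) < (((j + 1) + 3 * (j + 1).choose 2 + 3 * (j + 1).choose 3 + 2 * (j + 1).choose 4 : ℕ) : ℚ) := by
        positivity
      rw [div_le_div_iff₀ hQ hP]
      have hqq : (5 : ℚ) * (((j + 1) * (j + 2) * (j + 3) * (j + 4) : ℕ) : ℚ) ≤
          66 * (((j + 1) + 3 * (j + 1).choose 2 + 3 * (j + 1).choose 3 + 2 * (j + 1).choose 4 : ℕ) : ℚ) := by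
        exact_mod_cast hq
      have hcc : ((F.choose j : ℕ) : ℚ) * (((F + 1) * (F + 2) * (F + 3) * (F + 4) : ℕ) : ℚ) =
          (((F + 4).choose (j + 4) : ℕ) : ℚ) * (((j + 1) * (j + 2) * (j + 3) * (j + 4) : ℕ) : ℚ) := by
        exact_mod_cast hc
      have hc0 : (0 : ℚ) ≤ (((F + 4).choose (j + 4) : ℕ) : ℚ) := Nat.cast_nonneg _
      calc ((F.choose j : ℕ) : ℚ) * (((F + 1) * (F + 2) * (F + 3) * (F + 4) : ℕ) : ℚ)
          = (((F + 4).choose (j + 4) : ℕ) : ℚ) * (((j + 1) * (j + 2) * (j + 3) * (j + 4) : ℕ) : ℚ) := hcc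
        _ ≤ (((F + 4).choose (j + 4) : ℕ) : ℚ) * ((66 / 5 : ℚ) *
            (((j + 1) + 3 * (j + 1).choose 2 + 3 * (j + 1).choose 3 + 2 * (j + 1).choose 4 : ℕ) : ℚ)) := by
            apply mul_le_mul_of_nonneg_left _ hc0
            linarith [hqq]
        _ = (66 / 5 : ℚ) * (((F + 4).choose (j + 4) : ℕ) : ℚ) *
            (((j + 1) + 3 * (j + 1).choose 2 + 3 * (j + 1).choose 3 + 2 * (j + 1).choose 4 : ℕ) : ℚ) := by ring
    calc ∑ j ∈ Finset.Ico 60 D, ((F.choose j : ℕ) : ℚ) / (((j + 1) + 3 * (j + 1).choose 2 + 3 * (j + 1).choose 3 + 2 * (j + 1).choose 4 : ℕ) : ℚ)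
        ≤ ∑ j ∈ Finset.Ico 60 D, (66 / 5 : ℚ) * (((F + 4).choose (j + 4) : ℕ) : ℚ) / (((F + 1) * (F + 2) * (F + 3) * (F + 4) : ℕ) : ℚ) :=
          Finset.sum_le_sum hterm
      _ = (66 / 5 : ℚ) * ((∑ j ∈ Finset.Ico 60 D, (F + 4).choose (j + 4) : ℕ) : ℚ) / (((F + 1) * (F + 2) * (F + 3) * (F + 4) : ℕ) : ℚ) := by
          push_cast
          rw [Finset.mul_sum, Finset.sum_div]
      _ ≤ (66 / 5 : ℚ) * (2 ^ (F + 4) : ℚ) / (((F + 1) * (F + 2) * (F + 3) * (F + 4) : ℕ) : ℚ) := by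
          apply div_le_div_of_nonneg_right _ (le_of_lt hP)
          apply mul_le_mul_of_nonneg_left _ (by norm_num)
          exact_mod_cast sum_Ico_choose_add_four_le_two_pow F 60 D

end ThmN

end PercRepro
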